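import Summits.ValiantsHypothesis.ValiantsHypothesis.Theorems.BarrierLeverSigmaPiSigmaSliceEquations

/-!
# Route BarrierLever — the MODEL axis of crux `DefinableEquations` (stmt-ValiantsHypothesis-8745) /
# item `SingleSizeEquations` (8749): the depth-3 slices — part 3: the homogeneous slice sits inside
# the crux's class, and Nisan–Wigderson's own model (NON-homogeneous `ΣΠΣ` of bounded formal degree)

Continuation of `…SigmaPiSigmaSliceCertificate.lean` / `…SigmaPiSigmaSliceEquations.lean`.

1. `sigmaPiSigmaSlice_subset_smallCircuits`: for `n ≥ 3` the homogeneous depth-3 slice of top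
   fan-in `n^b` is contained in `SmallCircuits ℂ n (b + 3)` (a sum of `n^b` products of `≤ n` linear
   forms has degree `≤ n` and fan-in-two circuit size `≤ n^b (2n² + n + 2) ≤ n^{b+3}`), so the rung
   `naturalProofsAgainstSigmaPiSigma` is literally about a sub-slice of the class of item 8749.
2. Nisan–Wigderson's Lemma 3 is stated for GENERAL depth-3 circuits "with fanin `d` or less at every
   multiplication gate".  The certificate `spsCert n` of part 1 also vanishes on that model as long
   as the formal degree is `≤ 2k`, `k = ⌊n/9⌋`: `sigmaPiSigmaLowDegSlice n s` = sums of at most `s`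
   products of at most `2⌊n/9⌋` AFFINE forms (`eval_spsCert_eq_zero_affine`: expand each product by
   `Finset.prod_add`; a sub-product of `r` linear parts is homogeneous of degree `r`, so after
   `x^S ⌟ ·` only `r = 2k` survives the degree-`k` coefficient functional, and `r ≤ d_i ≤ 2k` then
   forces `d_i = 2k`, landing in the same `s · C(2k,k)`-dimensional space as in part 1).  Headlines:
   `naturalProofsAgainstLowDegSigmaPiSigma` (`∃ a = 18 ∀ b ∃ n₀ ∀ n ≥ n₀`),
   `not_isSuccinctHittingSet_lowDegSigmaPiSigma_of_lt_two_pow` (every top fan-in `s < 2^{⌊n/9⌋}`),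
   `sigmaPiSigmaLowDegSliceEquations` (boolean-sum form, `q = 0`), and
   `sigmaPiSigmaLowDegSlice_subset_smallCircuits`.
WHAT THIS IS NOT: nothing on general circuits (the crux, CT23 dir. 2), on `ΣΠΣ` of unbounded formal
degree (Ben-Or's interpolation computes `e_k(x²)` in size `O(n²)` with product fan-in `2n`), 8746,
14610 or VP vs VNP; classical (Nisan–Wigderson 1996, Lemma 3 / Theorem 0) mathematics made
FSV-natural and kernel-checked.
-/

-- layout Summits/ValiantsHypothesis/ValiantsHypothesis forces the duplicated namespace component
set_option linter.dupNamespace false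

noncomputable section

open MvPolynomial Finsupp

namespace Summit.ValiantsHypothesis.ValiantsHypothesis.Theorems.BarrierLever.SigmaPiSigmaSlice

open Literature.Computability.AlgebraicComplexity Literature.Barriers.ValiantsHypothesis
open SigmaLambdaSigmaSlice (det_eq_zero_of_rows_mem_submodule degree_sqfree)

section slice

variable {n : ℕ}

/-! ## The homogeneous slice is a sub-slice of `SmallCircuits` -/

/-- A linear form in `n` variables costs at most `2n` gates. [folklore] -/
theorem complexity_linForm_le (a : Fin n → ℂ) : complexity (linForm a) ≤ 2 * n := by
  have h1 : ∑ μ : Fin n, complexity (C (a μ) * (X μ : MvPolynomial (Fin n) ℂ)) ≤ ∑ _μ : Fin n, 1 := by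
    refine Finset.sum_le_sum fun μ _ => ?_
    calc complexity (C (a μ) * (X μ : MvPolynomial (Fin n) ℂ))
        ≤ complexity (C (a μ) : MvPolynomial (Fin n) ℂ) +
            complexity (X μ : MvPolynomial (Fin n) ℂ) + 1 := complexity_mul_le_holds _ _
      _ = 1 := by rw [complexity_C_holds, complexity_X_holds]
  have h2 := complexity_finset_sum_le (Finset.univ : Finset (Fin n))
    (fun μ => C (a μ) * (X μ : MvPolynomial (Fin n) ℂ))
  simp only [Finset.sum_const, Finset.card_univ, Fintype.card_fin, smul_eq_mul, mul_one] at h1 h2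
  rw [linForm]
  omega

/-- An affine form in `n` variables costs at most `2n + 1` gates. [folklore] -/
theorem complexity_affForm_le (a₀ : ℂ) (a : Fin n → ℂ) :
    complexity (C a₀ + linForm a) ≤ 2 * n + 1 := by
  have h1 : complexity (C a₀ + linForm a) ≤ complexity (C a₀ : MvPolynomial (Fin n) ℂ) +
      complexity (linForm a) + 1 := complexity_add_le_holds _ _
  have h2 := complexity_linForm_le a
  rw [complexity_C_holds] at h1
  omega

/-- Size of a sum of `s` scalar multiples of products of at most `D` factors of cost `≤ B` each:
`≤ s (D (B + 1) + 2)`. [cite: Burgisser2000, §2.1] -/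
theorem complexity_sum_C_mul_prod_le {s D B : ℕ} (c : Fin s → ℂ) (d : Fin s → ℕ)
    (P : Fin s → ℕ → MvPolynomial (Fin n) ℂ) (hd : ∀ i, d i ≤ D)
    (hP : ∀ i j, complexity (P i j) ≤ B) :
    complexity (∑ i : Fin s, C (c i) * ∏ j ∈ Finset.range (d i), P i j) ≤ s * (D * (B + 1) + 2) := by
  have hterm : ∀ i : Fin s,
      complexity (C (c i) * ∏ j ∈ Finset.range (d i), P i j) ≤ D * (B + 1) + 1 := by
    intro i
    calc complexity (C (c i) * ∏ j ∈ Finset.range (d i), P i j)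
        ≤ complexity (C (c i) : MvPolynomial (Fin n) ℂ) +
            complexity (∏ j ∈ Finset.range (d i), P i j) + 1 := complexity_mul_le_holds _ _
      _ ≤ 0 + (∑ j ∈ Finset.range (d i), complexity (P i j) + (Finset.range (d i)).card) + 1 := by
          rw [complexity_C_holds]
          exact Nat.add_le_add_right (Nat.add_le_add_left (complexity_finset_prod_le _ _) 0) 1
      _ ≤ 0 + (∑ _j ∈ Finset.range (d i), B + (Finset.range (d i)).card) + 1 := by
          gcongr with j _
          exact hP i j
      _ = d i * (B + 1) + 1 := by rw [Finset.sum_const, Finset.card_range, smul_eq_mul]; ring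
      _ ≤ D * (B + 1) + 1 := by have := hd i; nlinarith
  calc complexity (∑ i : Fin s, C (c i) * ∏ j ∈ Finset.range (d i), P i j)
      ≤ ∑ i : Fin s, complexity (C (c i) * ∏ j ∈ Finset.range (d i), P i j) +
          (Finset.univ : Finset (Fin s)).card := complexity_finset_sum_le _ _
    _ ≤ ∑ _i : Fin s, (D * (B + 1) + 1) + (Finset.univ : Finset (Fin s)).card := by
        gcongr with i _
        exact hterm i
    _ = s * (D * (B + 1) + 2) := by
        rw [Finset.sum_const, Finset.card_univ, Fintype.card_fin, smul_eq_mul]; ring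

/-- Size on the homogeneous slice: `L(f) ≤ s (n (2n+1) + 2)`. [cite: Burgisser2000, §2.1] -/
theorem complexity_le_of_mem_sigmaPiSigmaSlice {s : ℕ} {f : MvPolynomial (Fin n) ℂ}
    (hf : f ∈ sigmaPiSigmaSlice n s) : complexity f ≤ s * (n * (2 * n + 1) + 2) := by
  obtain ⟨c, d, a, hd, rfl⟩ := hf
  exact complexity_sum_C_mul_prod_le c d (fun i j => linForm (a i j)) hd
    fun i j => complexity_linForm_le (a i j)

/-- **The homogeneous depth-3 slice is a sub-slice of the crux's class**: for `n ≥ 3`,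
`sigmaPiSigmaSlice n (n^b) ⊆ SmallCircuits ℂ n (b + 3)`. [folklore] -/
theorem sigmaPiSigmaSlice_subset_smallCircuits {b : ℕ} (hn : 3 ≤ n) :
    sigmaPiSigmaSlice n (n ^ b) ⊆ SmallCircuits ℂ n (b + 3) := by
  intro f hf
  refine ⟨totalDegree_le_of_mem_sigmaPiSigmaSlice hf, (complexity_le_of_mem_sigmaPiSigmaSlice hf).trans ?_⟩
  have h3 : 3 * n ≤ n * n := Nat.mul_le_mul_right n hn
  have h : n * (2 * n + 1) + 2 ≤ n ^ 3 := by
    calc n * (2 * n + 1) + 2 = 2 * (n * n) + (n + 2) := by ring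
      _ ≤ 2 * (n * n) + n * n := by omega
      _ = 3 * (n * n) := by ring
      _ ≤ n * (n * n) := Nat.mul_le_mul_right _ hn
      _ = n ^ 3 := by ring
  calc n ^ b * (n * (2 * n + 1) + 2) ≤ n ^ b * n ^ 3 := Nat.mul_le_mul_left _ h
    _ = n ^ (b + 3) := by rw [← pow_add]

/-! ## Nisan–Wigderson's model: depth-3 circuits of bounded formal degree (affine forms) -/

variable (n) in
/-- **The bounded-formal-degree depth-3 slice** (`ΣΠΣ` of top fan-in `≤ s` with fan-in `≤ 2⌊n/9⌋`
at every multiplication gate): sums of at most `s` scalar multiples of products `∏_{j<d_i} A_{ij}`,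
`d_i ≤ 2⌊n/9⌋`, of AFFINE forms `A_{ij} = a₀ + Σ_μ a_μ x_μ` (not necessarily homogeneous).
[cite: NisanWigderson1996, §3 (Lemma 3)] -/
def sigmaPiSigmaLowDegSlice (s : ℕ) : Set (MvPolynomial (Fin n) ℂ) :=
  {f | ∃ (c : Fin s → ℂ) (d : Fin s → ℕ) (a₀ : Fin s → ℕ → ℂ) (a : Fin s → ℕ → Fin n → ℂ),
    (∀ i, d i ≤ 2 * (n / 9)) ∧
    f = ∑ i : Fin s, C (c i) *
      ∏ j ∈ Finset.range (d i), (C (a₀ i j) + ∑ μ : Fin n, C (a i j μ) * X μ)}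

/-- After `x^S ⌟ ·`, an element of `prodSpan a m (2k)` has its degree-`k` square-free coefficient
vector inside `kCoeffs (prodSpan a m k)`. [cite: NisanWigderson1996, §3 (Lemma 3)] -/
theorem kCoeffs_apolarAction_mem_map (a : ℕ → Fin n → ℂ) (m : ℕ) {g : MvPolynomial (Fin n) ℂ}
    (hg : g ∈ prodSpan a m (n / 9 + n / 9)) (S : KSub n) :
    kCoeffs n (apolarAction (monomial (sqfree S.1) 1) g) ∈
      (prodSpan a m (n / 9)).map (kCoeffs n) := by
  refine Submodule.mem_map_of_mem (apolarAction_sqfree_mem_prodSpan a m S.1 (n / 9) g ?_)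
  rwa [S.2]

/-- After `x^S ⌟ ·`, an element of `prodSpan a m r` with `r ≠ 2k` has NO degree-`k` square-free
coefficients (homogeneity). [folklore] -/
theorem kCoeffs_apolarAction_eq_zero (a : ℕ → Fin n → ℂ) (m : ℕ) {r : ℕ} (hr : r ≠ 2 * (n / 9))
    {g : MvPolynomial (Fin n) ℂ} (hg : g ∈ prodSpan a m r) (S : KSub n) :
    kCoeffs n (apolarAction (monomial (sqfree S.1) 1) g) = 0 :=
  kCoeffs_eq_zero_of_isHomogeneous
    (apolarAction_isHomogeneous (isHomogeneous_monomial _ (by rw [degree_sqfree, S.2]))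
      (isHomogeneous_of_mem_prodSpan a m r hg)) (by omega)

/-- **The certificate vanishes on depth-3 circuits of formal degree `≤ 2k`**: if
`s · C(2k,k) < C(n,k)`, `k = ⌊n/9⌋`, then `spsCert n` vanishes at
`coeff (Σ_{i<s} c_i ∏_{j<d_i} (a₀_{ij} + ℓ_{ij}))` for all affine forms, provided `d_i ≤ 2k`.
[cite: NisanWigderson1996, §3 (Lemma 3, Theorem 0)] -/
theorem eval_spsCert_eq_zero_affine {s : ℕ} (c : Fin s → ℂ) (d : Fin s → ℕ) (a₀ : Fin s → ℕ → ℂ)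
    (a : Fin s → ℕ → Fin n → ℂ) (hd : ∀ i, d i ≤ 2 * (n / 9))
    (hs : s * (2 * (n / 9)).choose (n / 9) < n.choose (n / 9)) :
    eval (coeffVector (degLEMonomials n)
      (∑ i : Fin s, C (c i) * ∏ j ∈ Finset.range (d i), (C (a₀ i j) + linForm (a i j))))
        (spsCert n) = 0 := by
  classical
  let pc := (Finset.range (2 * (n / 9))).powersetCard (n / 9)
  let gvec : Fin s × pc → (KSub n → ℂ) := fun p =>
    if d p.1 = 2 * (n / 9) then kCoeffs n (∏ j ∈ (p.2 : Finset ℕ), linForm (a p.1 j)) else 0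
  let W : Submodule ℂ (KSub n → ℂ) := Submodule.span ℂ (Set.range gvec)
  -- the image of `kCoeffs (prodSpan (a i) (d i) k)` lies in `W` when `d i = 2k`
  have hW : ∀ i : Fin s, d i = 2 * (n / 9) → (prodSpan (a i) (d i) (n / 9)).map (kCoeffs n) ≤ W := by
    intro i hdi
    refine (Submodule.map_span_le _ _ _).mpr ?_
    rintro _ ⟨J, rfl⟩
    have hJ := Finset.mem_powersetCard.mp J.2
    refine Submodule.subset_span ⟨(i, ⟨(J : Finset ℕ), Finset.mem_powersetCard.mpr
      ⟨fun x hx => Finset.mem_range.mpr (by have := Finset.mem_range.mp (hJ.1 hx); omega),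
        hJ.2⟩⟩), ?_⟩
    simp only [gvec, if_pos hdi]
  rw [eval_spsCert]
  refine det_eq_zero_of_rows_mem_submodule _ W ?_ fun S => ?_
  · calc Module.finrank ℂ W ≤ Fintype.card (Fin s × pc) := finrank_range_le_card gvec
      _ = s * (2 * (n / 9)).choose (n / 9) := by
          rw [Fintype.card_prod, Fintype.card_fin, Fintype.card_coe, Finset.card_powersetCard,
            Finset.card_range]
      _ < n.choose (n / 9) := hs
      _ = Fintype.card (KSub n) := by rw [Fintype.card_finset_len, Fintype.card_fin]
  · rw [row_eq_kCoeffs_apolarAction, apolarAction_sum_right, map_sum]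
    refine Submodule.sum_mem _ fun i _ => ?_
    rw [← smul_eq_C_mul, apolarAction_smul_right, map_smul]
    refine Submodule.smul_mem _ _ ?_
    -- expand the product of affine forms into sub-products of linear parts
    rw [Finset.prod_add, apolarAction_sum_right, map_sum]
    refine Submodule.sum_mem _ fun t _ => ?_
    rw [← map_prod C, ← smul_eq_C_mul, apolarAction_smul_right, map_smul]
    refine Submodule.smul_mem _ _ ?_
    set J := Finset.range (d i) \ t with hJdef
    have hJd : J.card ≤ d i := (Finset.card_le_card Finset.sdiff_subset).trans
      (by rw [Finset.card_range])
    have hQ : (∏ j ∈ J, linForm (a i j)) ∈ prodSpan (a i) (d i) J.card :=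
      Submodule.subset_span ⟨⟨J, Finset.mem_powersetCard.mpr ⟨Finset.sdiff_subset, rfl⟩⟩, rfl⟩
    by_cases hJ : J.card = 2 * (n / 9)
    · have hdi : d i = 2 * (n / 9) := by have := hd i; omega
      rw [hJ, two_mul] at hQ
      exact hW i hdi (kCoeffs_apolarAction_mem_map (a i) (d i) hQ S)
    · rw [kCoeffs_apolarAction_eq_zero (a i) (d i) hJ hQ S]
      exact Submodule.zero_mem _

/-- Slice form: `spsCert n` vanishes on `sigmaPiSigmaLowDegSlice n s` whenever
`s · C(2k,k) < C(n,k)`. [cite: NisanWigderson1996, §3 (Lemma 3, Theorem 0)] -/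
theorem eval_spsCert_eq_zero_of_mem_lowDeg {s : ℕ}
    (hs : s * (2 * (n / 9)).choose (n / 9) < n.choose (n / 9))
    {f : MvPolynomial (Fin n) ℂ} (hf : f ∈ sigmaPiSigmaLowDegSlice n s) :
    eval (coeffVector (degLEMonomials n) f) (spsCert n) = 0 := by
  obtain ⟨c, d, a₀, a, hd, rfl⟩ := hf
  exact eval_spsCert_eq_zero_affine c d a₀ a hd hs

/-- **Natural proof against depth-3 circuits of formal degree `≤ 2⌊n/9⌋`** at every top fan-in `s`
with `s · C(2k,k) < C(n,k)` (`n ≥ 1`), at level 18. [cite: ForbesShpilkaVolk2018, Def. 1] -/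
theorem isNaturalProof_spsCert_lowDeg {s : ℕ} (hn : 1 ≤ n)
    (hs : s * (2 * (n / 9)).choose (n / 9) < n.choose (n / 9)) :
    IsNaturalProof (degLEMonomials n) (sigmaPiSigmaLowDegSlice n s) (Distinguishers ℂ n 18)
      (spsCert n) :=
  ⟨spsCert_mem_distinguishers hn, spsCert_ne_zero, fun _ hf => eval_spsCert_eq_zero_of_mem_lowDeg hs hf⟩

/-- **Exponential top fan-in at one level** for the bounded-formal-degree model: for `n ≥ 9` and
every `s < 2^{⌊n/9⌋}`, the slice `sigmaPiSigmaLowDegSlice n s` is not a succinct hitting set for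
`Distinguishers ℂ n 18`. [cite: NisanWigderson1996, §3 (Theorem 0)] -/
theorem not_isSuccinctHittingSet_lowDegSigmaPiSigma_of_lt_two_pow (hn : 9 ≤ n) {s : ℕ}
    (hs : s < 2 ^ (n / 9)) :
    ¬ IsSuccinctHittingSet (degLEMonomials n) (sigmaPiSigmaLowDegSlice n s)
      (Distinguishers ℂ n 18) :=
  (exists_isNaturalProof_iff _ _ _).mp
    ⟨_, isNaturalProof_spsCert_lowDeg (by omega)
      (mul_centralBinom_lt_choose_of_lt_two_pow (by omega) hs)⟩

/-- Size on the bounded-formal-degree slice: `L(f) ≤ s (2⌊n/9⌋ (2n+2) + 2)`. [cite: Burgisser2000, §2.1] -/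
theorem complexity_le_of_mem_sigmaPiSigmaLowDegSlice {s : ℕ} {f : MvPolynomial (Fin n) ℂ}
    (hf : f ∈ sigmaPiSigmaLowDegSlice n s) :
    complexity f ≤ s * (2 * (n / 9) * (2 * n + 2) + 2) := by
  obtain ⟨c, d, a₀, a, hd, rfl⟩ := hf
  exact complexity_sum_C_mul_prod_le c d (fun i j => C (a₀ i j) + linForm (a i j)) hd
    fun i j => complexity_affForm_le (a₀ i j) (a i j)

/-- Degree on the bounded-formal-degree slice: `deg f ≤ 2⌊n/9⌋ ≤ n`. [folklore] -/
theorem totalDegree_le_of_mem_sigmaPiSigmaLowDegSlice {s : ℕ} {f : MvPolynomial (Fin n) ℂ}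
    (hf : f ∈ sigmaPiSigmaLowDegSlice n s) : f.totalDegree ≤ n := by
  classical
  obtain ⟨c, d, a₀, a, hd, rfl⟩ := hf
  show (∑ i : Fin s, C (c i) * ∏ j ∈ Finset.range (d i), (C (a₀ i j) + linForm (a i j))).totalDegree ≤ n
  refine (totalDegree_finsetSum _ _).trans (Finset.sup_le fun i _ => ?_)
  refine (totalDegree_mul _ _).trans ?_
  rw [totalDegree_C, zero_add]
  refine (totalDegree_finsetProd _ _).trans ?_
  refine (Finset.sum_le_sum fun j _ => show (C (a₀ i j) + linForm (a i j)).totalDegree ≤ 1 from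
    (totalDegree_add _ _).trans (max_le (by rw [totalDegree_C]; exact Nat.zero_le 1)
      (isHomogeneous_linForm (a i j)).totalDegree_le)).trans ?_
  rw [Finset.sum_const, Finset.card_range, smul_eq_mul, mul_one]
  have := hd i
  omega

/-- **The bounded-formal-degree slice is a sub-slice of the crux's class**: for `n ≥ 3`,
`sigmaPiSigmaLowDegSlice n (n^b) ⊆ SmallCircuits ℂ n (b + 3)`. [folklore] -/
theorem sigmaPiSigmaLowDegSlice_subset_smallCircuits {b : ℕ} (hn : 3 ≤ n) :
    sigmaPiSigmaLowDegSlice n (n ^ b) ⊆ SmallCircuits ℂ n (b + 3) := by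
  intro f hf
  refine ⟨totalDegree_le_of_mem_sigmaPiSigmaLowDegSlice hf,
    (complexity_le_of_mem_sigmaPiSigmaLowDegSlice hf).trans ?_⟩
  have h9 : 2 * (n / 9) ≤ n := by omega
  have h3 : 3 * n ≤ n * n := Nat.mul_le_mul_right n hn
  have h : 2 * (n / 9) * (2 * n + 2) + 2 ≤ n ^ 3 := by
    calc 2 * (n / 9) * (2 * n + 2) + 2 ≤ n * (2 * n + 2) + 2 :=
          Nat.add_le_add_right (Nat.mul_le_mul_right _ h9) 2
      _ = 2 * (n * n) + (2 * n + 2) := by ring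
      _ ≤ 2 * (n * n) + n * n := by omega
      _ = 3 * (n * n) := by ring
      _ ≤ n * (n * n) := Nat.mul_le_mul_right _ hn
      _ = n ^ 3 := by ring
  calc n ^ b * (2 * (n / 9) * (2 * n + 2) + 2) ≤ n ^ b * n ^ 3 := Nat.mul_le_mul_left _ h
    _ = n ^ (b + 3) := by rw [← pow_add]

end slice

/-- **HEADLINE (bounded formal degree) — the crux's quantifier shape `∃ a ∀ b` on Nisan–Wigderson's
model.**  There is ONE level `a` (`= 18`) such that for EVERY `b`, for all `n ≥ 162 · 16^b`, the
polynomials computed by depth-3 circuits (affine forms at the bottom, NOT necessarily homogeneous) of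
top fan-in `n^b` and formal degree `≤ 2⌊n/9⌋` are NOT a succinct hitting set for
`Distinguishers ℂ n a`. [cite: NisanWigderson1996, §3 (Lemma 3, Theorem 0)] -/
theorem naturalProofsAgainstLowDegSigmaPiSigma : ∃ a : ℕ, ∀ b : ℕ, ∃ n₀ : ℕ, ∀ n ≥ n₀,
    ¬ IsSuccinctHittingSet (degLEMonomials n) (sigmaPiSigmaLowDegSlice n (n ^ b))
      (Distinguishers ℂ n a) := by
  refine ⟨18, fun b => ⟨162 * 16 ^ b, fun n hn => ?_⟩⟩
  have hn1 : 1 ≤ n := le_trans (by have := Nat.one_le_pow b 16 (by norm_num); omega) hn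
  exact (exists_isNaturalProof_iff _ _ _).mp
    ⟨_, isNaturalProof_spsCert_lowDeg hn1 (pow_mul_centralBinom_lt_choose hn)⟩

/-- **The 8745-shaped statement on the bounded-formal-degree slice** (boolean-sum form, `q = 0`).
[cite: NisanWigderson1996, §3 (Lemma 3, Theorem 0)] -/
theorem sigmaPiSigmaLowDegSliceEquations : ∃ a : ℕ, ∀ b : ℕ, ∃ n₀ : ℕ, ∀ n ≥ n₀,
    ∃ q : ℕ, q ≤ (Nat.choose (2 * n) n) ^ a ∧
      ∃ H : MvPolynomial (↥(degLEMonomials n) ⊕ Fin q) ℂ,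
        complexity H ≤ (Nat.choose (2 * n) n) ^ a ∧ H.totalDegree ≤ (Nat.choose (2 * n) n) ^ a ∧
        boolSum H ≠ 0 ∧
        ∀ f ∈ sigmaPiSigmaLowDegSlice n (n ^ b),
          eval (coeffVector (degLEMonomials n) f) (boolSum H) = 0 := by
  refine ⟨18, fun b => ⟨162 * 16 ^ b, fun n hn =>
    ⟨0, Nat.zero_le _, MvPolynomial.rename Sum.inl (spsCert n), ?_⟩⟩⟩
  have hn1 : 1 ≤ n := le_trans (by have := Nat.one_le_pow b 16 (by norm_num); omega) hn
  obtain ⟨hD, hne, hvan⟩ := isNaturalProof_spsCert_lowDeg hn1 (pow_mul_centralBinom_lt_choose hn)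
  obtain ⟨hc, hdeg, hsum⟩ := SingleSizeEquations.distinguisher_isBoolSum hD
  refine ⟨hc, hdeg, by rwa [hsum], fun f hf => ?_⟩
  rw [hsum]
  exact hvan f hf

end Summit.ValiantsHypothesis.ValiantsHypothesis.Theorems.BarrierLever.SigmaPiSigmaSlice

end
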